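import Mathlib
import Summits.Ventures.PercRepro2.PendantRoot
import Summits.Ventures.PercRepro2.HCovSwap
import Summits.Ventures.PercRepro2.PMK5PendantRootA
import Summits.Ventures.PercRepro2.PMK5PendantBMasses
import Summits.Ventures.PercRepro2.PMK5LocusPendantRoot
import Summits.Ventures.PercRepro2.PMK5LocusZeroSSb

/-!
# THEOREM 22′ — THE EQUALITY LOCUS OF (HCOV) ON `K₅ + a₃ PENDANT AT THE ROOT a₁` (the mirror of Theorem 22)
(blind cell PercRepro2, mine-2 g24; `K5.PendRA.ends6ra`: `K₅` on `o = 0, a₁ = 1, a₂ = 2, u = 3, b = 4` plus the pendant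
edge `{1, 5}` to the leaf `a₃ = 5` at `a₁`; through the root symmetry `HCovSwap.Gc_swap` and the pendant-at-root
identity `PendantRoot.Gc_pendant_root` applied with the roots interchanged; the `a₂`-side same-side slack `SS′` of
`PMK5LocusSSb*`, locus `RuleSSb`)

(**`gc6ra_eq`**) `Gc(p) = 2 (1 − q) P · [q · SS′ + (1 − q) · Z_L + Z_H]` with `SS′ = P·B − oH·bH ≥ 0`; on the pendant
face (`0 < q < 1`) the locus of (HCOV) is EXACTLY `RuleSSb` = «the root pair separates `o` from `b`, or `a₂` cannot
reach `o` avoiding `a₁`» (480 / 1,024; the `a₁`-clause of `RuleA` disappears when `a₃` hangs at `a₁`), `RuleSSb ⊆ RuleA`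
(`ruleA_of_ruleSSb`); at `q = 0` the locus is `RuleA`, at `q = 1` (`a₃ = a₁`) the crux functional vanishes identically.
Standard axioms.
-/

namespace Summit.Ventures.PercRepro2

open Hub CovForm

namespace K5

namespace PM

set_option maxRecDepth 100000 in
/-- **Every `SS′`-degenerate edge set is `A`-degenerate** (480 ⊆ 560). -/
theorem ruleA_of_ruleSSb : ∀ m : Fin 1024, RuleSSb m = true → RuleA m = true := by
  decide +kernel

section Masses

variable {R : Type*} [Field R] [LinearOrder R] [IsStrictOrderedRing R]

/-- The `a₂`-side same-side slack `SS′ = P·B − oH·bH`. -/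
noncomputable def SSbm (s : Fin 10 → R) : R := Pm s * Bm s - oHm s * bHm s

/-- `SS′ ≥ 0` (Harris on `C₂`: `covC_same_nonneg` with the roots interchanged). -/
lemma SSbm_nonneg (s : Fin 10 → R) (hs : IsProbVec s) : 0 ≤ SSbm s := by
  have := PendantRoot.covC_same_nonneg s ends5 hs 0 2 1 4
  unfold PendantRoot.covC at this
  rw [CovForm.avoidAll_root_swap] at this
  unfold SSbm Pm Bm oHm bHm Qev; linarith

omit [LinearOrder R] [IsStrictOrderedRing R] in
/-- **`SS′` is the `SS′` Bernstein form.** -/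
theorem SSb_eq_bern (s : Fin 10 → R) :
    SSbm s = ∑ k, bern s k * ((cntPosSSb k : ℕ) - (cntNegSSb k : ℕ) : R) := by
  rw [← ssb_eq_bern]; rfl

end Masses

section Family

variable {R : Type*} [Field R] [LinearOrder R] [IsStrictOrderedRing R]

omit [LinearOrder R] [IsStrictOrderedRing R] in
/-- The connection events among the marks transfer (numeral forms). -/
lemma c12ra : connEvent PendRA.ends6ra 1 2 = PendRA.resra ⁻¹' connEvent ends5 1 2 := by
  have h := PendRA.connEvent6ra_eq 1 2; rwa [Pendant.cs1, Pendant.cs2] at h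
omit [LinearOrder R] [IsStrictOrderedRing R] in
/-- The connection events among the marks transfer (numeral forms). -/
lemma c21ra : connEvent PendRA.ends6ra 2 1 = PendRA.resra ⁻¹' connEvent ends5 2 1 := by
  have h := PendRA.connEvent6ra_eq 2 1; rwa [Pendant.cs2, Pendant.cs1] at h
omit [LinearOrder R] [IsStrictOrderedRing R] in
/-- The connection events among the marks transfer (numeral forms). -/
lemma c14ra : connEvent PendRA.ends6ra 1 4 = PendRA.resra ⁻¹' connEvent ends5 1 4 := by
  have h := PendRA.connEvent6ra_eq 1 4; rwa [Pendant.cs1, Pendant.cs4] at h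
omit [LinearOrder R] [IsStrictOrderedRing R] in
/-- The connection events among the marks transfer (numeral forms). -/
lemma c24ra : connEvent PendRA.ends6ra 2 4 = PendRA.resra ⁻¹' connEvent ends5 2 4 := by
  have h := PendRA.connEvent6ra_eq 2 4; rwa [Pendant.cs2, Pendant.cs4] at h
omit [LinearOrder R] [IsStrictOrderedRing R] in
/-- The connection events among the marks transfer (numeral forms). -/
lemma c10ra : connEvent PendRA.ends6ra 1 0 = PendRA.resra ⁻¹' connEvent ends5 1 0 := by
  have h := PendRA.connEvent6ra_eq 1 0; rwa [Pendant.cs1, Pendant.cs0] at h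
omit [LinearOrder R] [IsStrictOrderedRing R] in
/-- The connection events among the marks transfer (numeral forms). -/
lemma c20ra : connEvent PendRA.ends6ra 2 0 = PendRA.resra ⁻¹' connEvent ends5 2 0 := by
  have h := PendRA.connEvent6ra_eq 2 0; rwa [Pendant.cs2, Pendant.cs0] at h
omit [LinearOrder R] [IsStrictOrderedRing R] in
/-- `Q` transfers (the swapped form `avoidAll 1 {2}`). -/
lemma avoidAll6ra : avoidAll PendRA.ends6ra 1 {2} = PendRA.resra ⁻¹' avoidAll ends5 2 {1} := by
  rw [CovForm.avoidAll_root_swap, PMPendant.avoidAll_eq_compl, PMPendant.avoidAll_eq_compl, c12ra,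
    Set.preimage_compl]

omit [LinearOrder R] [IsStrictOrderedRing R] in
/-- The pendant edge of `ends6ra` joins `a₃ = 5` to `a₁ = 1`. -/
lemma ends6ra_last' : PendRA.ends6ra (Fin.last 10) = s(5, 1) := by
  rw [PendRA.ends6ra_last, Sym2.eq_swap]

/-- **The crux functional on `K₅ + a₃ pendant at a₁`**: `2 (1 − q) P [q · SS′ + (1 − q) · Z_L + Z_H]`. -/
theorem gc6ra_eq (p : Fin 11 → R) :
    Gc p PendRA.ends6ra 0 1 2 5 4 =
      2 * (1 - p (Fin.last 10)) * Pm (p ∘ Fin.castSucc) *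
        (p (Fin.last 10) * SSbm (p ∘ Fin.castSucc) + (1 - p (Fin.last 10)) * ZL (p ∘ Fin.castSucc) +
          ZH (p ∘ Fin.castSucc)) := by
  rw [CovForm.Gc_swap p PendRA.ends6ra 0 2 1 5 4,
    PendantRoot.Gc_pendant_root p PendRA.ends6ra ends6ra_last' PendRA.leaf_five_ra (by decide) (by decide)
    (by decide) (by decide)]
  unfold PendantRoot.covC
  simp only [avoidAll6ra, c14ra, c24ra, c10ra, c20ra, ← Set.preimage_inter, PendRA.prob_resra]
  unfold SSbm ZL ZH Pm Bm oHm bHm oLm bLm Ddm Cm Qev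
  ring

end Family

section Locus

variable {R : Type*} [Field R] [LinearOrder R] [IsStrictOrderedRing R]

/-- **THEOREM 22′ — THE ZERO SIDE**: on every `SS′`-degenerate base edge set `Gc ≡ 0`, for every pendant weight. -/
theorem gc6ra_zero_of_face (m : ℕ) (hm : m < 1024) (hr : RuleSSb m = true) (p : Fin 11 → R)
    (hp : ∀ e : Fin 11, 0 ≤ p e ∧ p e ≤ 1)
    (hp₀ : ∀ e : Fin 10, m.testBit e = false → p (Fin.castSucc e) = 0) :
    Gc p PendRA.ends6ra 0 1 2 5 4 = 0 := by
  rw [gc6ra_eq]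
  set s := p ∘ Fin.castSucc with hs_def
  have hs : IsProbVec s := ⟨fun _ => (hp _).1, fun _ => (hp _).2⟩
  have hs₀ : ∀ e : Fin 10, m.testBit e = false → s e = 0 := fun e he => hp₀ e he
  have hSS : SSbm s = 0 := by rw [SSb_eq_bern]; exact ssb_K5_zero_of_face m hm hr s hs₀
  have hI : 2 * Pm s * (ZL s + ZH s) = 0 := by
    rw [twoPZ_eq_bern]; exact i_K5_zero_of_face m hm (ruleA_of_ruleSSb ⟨m, hm⟩ hr) s hs₀
  rcases (Pm_nonneg s hs).lt_or_eq with hP | hP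
  · have hZ : ZL s + ZH s = 0 := by
      rcases mul_eq_zero.1 hI with h | h
      · exfalso; linarith
      · exact h
    have hZL : ZL s = 0 := by linarith [ZL_nonneg' s hs, ZH_nonneg' s hs]
    have hZH : ZH s = 0 := by linarith [ZL_nonneg' s hs, ZH_nonneg' s hs]
    rw [hSS, hZL, hZH]; ring
  · rw [← hP]; ring

/-- **THEOREM 22′ — THE POSITIVE SIDE**: on every base edge set that is not `SS′`-degenerate, `Gc > 0` at every
weight vector interior on the base with pendant weight `0 < q < 1`. -/
theorem gc6ra_pos_of_face (m : ℕ) (hm : m < 1024) (hr : RuleSSb m = false) (p : Fin 11 → R)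
    (hp₁ : ∀ e : Fin 10, m.testBit e = true → 0 < p (Fin.castSucc e) ∧ p (Fin.castSucc e) < 1)
    (hp₀ : ∀ e : Fin 10, m.testBit e = false → p (Fin.castSucc e) = 0)
    (hq : 0 < p (Fin.last 10) ∧ p (Fin.last 10) < 1) :
    0 < Gc p PendRA.ends6ra 0 1 2 5 4 := by
  rw [gc6ra_eq]
  set s := p ∘ Fin.castSucc with hs_def
  have h01 : ∀ e : Fin 10, 0 ≤ s e ∧ s e ≤ 1 := fun e => by
    by_cases he : m.testBit e = true
    · exact ⟨(hp₁ e he).1.le, (hp₁ e he).2.le⟩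
    · show 0 ≤ p (Fin.castSucc e) ∧ p (Fin.castSucc e) ≤ 1
      rw [hp₀ e (by simpa using he)]
      exact ⟨le_rfl, zero_le_one⟩
  have hs : IsProbVec s := ⟨fun e => (h01 e).1, fun e => (h01 e).2⟩
  have hlt : ∀ e, s e < 1 := fun e => by
    by_cases he : m.testBit e = true
    · exact (hp₁ e he).2
    · show p (Fin.castSucc e) < 1
      rw [hp₀ e (by simpa using he)]; exact zero_lt_one
  have hs₁ : ∀ e : Fin 10, m.testBit e = true → 0 < s e ∧ s e < 1 := fun e he => hp₁ e he
  have hs₀ : ∀ e : Fin 10, m.testBit e = false → s e = 0 := fun e he => hp₀ e he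
  have hP := Pm_pos s hs hlt
  have hq1 : 0 < 1 - p (Fin.last 10) := sub_pos.2 hq.2
  have hSS := SSbm_nonneg s hs
  have hZL := ZL_nonneg' s hs
  have hZH := ZH_nonneg' s hs
  have hbr : 0 < p (Fin.last 10) * SSbm s + (1 - p (Fin.last 10)) * ZL s + ZH s := by
    rcases Bool.eq_false_or_eq_true (RuleA m) with hA | hA
    · have hS : 0 < SSbm s := by rw [SSb_eq_bern]; exact ssb_K5_pos_of_face m hm hr s hs₁ hs₀
      have := mul_pos hq.1 hS
      have := mul_nonneg hq1.le hZL
      linarith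
    · have hI : 0 < 2 * Pm s * (ZL s + ZH s) := by
        rw [twoPZ_eq_bern]; exact i_K5_pos_of_face m hm hA s hs₁ hs₀
      have hZ : 0 < ZL s + ZH s := by
        rcases (add_nonneg hZL hZH).lt_or_eq with h | h
        · exact h
        · exfalso; rw [← h, mul_zero] at hI; exact lt_irrefl _ hI
      have h3 : (1 - p (Fin.last 10)) * (ZL s + ZH s) ≤ (1 - p (Fin.last 10)) * ZL s + ZH s := by
        have : (1 - p (Fin.last 10)) * ZH s ≤ ZH s := by
          have := mul_le_of_le_one_left hZH (by linarith : 1 - p (Fin.last 10) ≤ 1)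
          linarith
        linarith
      have := mul_pos hq1 hZ
      have := mul_nonneg hq.1.le hSS
      linarith
  have h2 : 0 < 2 * (1 - p (Fin.last 10)) * Pm s := by positivity
  exact mul_pos h2 hbr

/-- **THEOREM 22′, FIRST «IFF»**: `Gc > 0` at every weight vector interior on the pendant face of `m` (`0 < q < 1`)
⟺ `m` is not `SS′`-degenerate. -/
theorem gc6ra_pos_iff (m : ℕ) (hm : m < 1024) :
    (∀ p : Fin 11 → R, (∀ e : Fin 10, m.testBit e = true → 0 < p (Fin.castSucc e) ∧ p (Fin.castSucc e) < 1) →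
      (∀ e : Fin 10, m.testBit e = false → p (Fin.castSucc e) = 0) →
      (0 < p (Fin.last 10) ∧ p (Fin.last 10) < 1) → 0 < Gc p PendRA.ends6ra 0 1 2 5 4) ↔ RuleSSb m = false := by
  constructor
  · intro h
    rcases Bool.eq_false_or_eq_true (RuleSSb m) with hr | hr
    · exfalso
      have hpos := h (centreR (R := R) m) (fun e he => by rw [centreR_castSucc]; exact centre_on_pos he)
        (fun e he => by rw [centreR_castSucc]; exact centre_off he)
        (by rw [centreR_last]; exact ⟨by norm_num, by norm_num⟩)
      have hzero := gc6ra_zero_of_face m hm hr (centreR (R := R) m) (centreR_01 m)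
        (fun e he => by rw [centreR_castSucc]; exact centre_off he)
      rw [hzero] at hpos
      exact lt_irrefl _ hpos
    · exact hr
  · intro hr p hp₁ hp₀ hq
    exact gc6ra_pos_of_face m hm hr p hp₁ hp₀ hq

/-- **THEOREM 22′, SECOND «IFF»**: `Gc = 0` at every admissible weight vector whose `K₅` weights are supported on `m`
⟺ `m` is `SS′`-degenerate. -/
theorem gc6ra_zero_iff (m : ℕ) (hm : m < 1024) :
    (∀ p : Fin 11 → R, (∀ e : Fin 11, 0 ≤ p e ∧ p e ≤ 1) →
      (∀ e : Fin 10, m.testBit e = false → p (Fin.castSucc e) = 0) →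
      Gc p PendRA.ends6ra 0 1 2 5 4 = 0) ↔ RuleSSb m = true := by
  constructor
  · intro h
    rcases Bool.eq_false_or_eq_true (RuleSSb m) with hr | hr
    · exact hr
    · exfalso
      have hpos := gc6ra_pos_of_face m hm hr (centreR (R := R) m)
        (fun e he => by rw [centreR_castSucc]; exact centre_on_pos he)
        (fun e he => by rw [centreR_castSucc]; exact centre_off he)
        (by rw [centreR_last]; exact ⟨by norm_num, by norm_num⟩)
      have hzero := h (centreR (R := R) m) (centreR_01 m)
        (fun e he => by rw [centreR_castSucc]; exact centre_off he)
      rw [hzero] at hpos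
      exact lt_irrefl _ hpos
  · intro hr p hp hp₀
    exact gc6ra_zero_of_face m hm hr p hp hp₀

/-- **The glued face `q = 1` (`a₃ = a₁`)**: the crux functional vanishes identically. -/
theorem gc6ra_glued_zero (p : Fin 11 → R) :
    Gc (Function.update p (Fin.last 10) 1) PendRA.ends6ra 0 1 2 5 4 = 0 := by
  rw [gc6ra_eq, Function.update_self]
  ring

end Locus

end PM

end K5

end Summit.Ventures.PercRepro2
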